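import Summits.PneNP.PneNP.Theorems.PermanentDescentCollapseMakesPermanentEasyDefs
import Literature.Computability.Complexity.DeterminantFP
import Literature.Computability.Complexity.CodeFPStrings
import Literature.Computability.Complexity.CodeFPLists
import Literature.Computability.Complexity.LundEtAl1992Proofs
import Mathlib.LinearAlgebra.Matrix.Determinant.Basic
import Mathlib.LinearAlgebra.Matrix.Permanent
import Mathlib.Data.ZMod.Basic
import Mathlib.Algebra.CharP.Two

/-!
# Route PermanentDescent, crux `PermanentNotInP` (stmt-PneNP-16143), line `Sketch` (xp-ladder) —
# the BASE of the precision ladder: `PermLowBits 1 ∈ P` (and `PermLowBits 0 = ∅ ∈ P`)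

The line `Sketch` (card `Cruxes/PermanentNotInP/Ideas/xp-ladder-middle-bits.md`) reads the crux
`PermBits ∉ P` as the limit rung of the 2-adic precision ladder
`PermLowBits k = {⟨s, bin i⟩ ∈ PermBits | i < k}`; its transfer (stubs A `stub_preimageFST`, B
`stub_guardFST`, both landed) shows that ONE polynomial-time decider for `PermBits` would put every
rung in a single `DTIME(n^c)`, so the crux follows from the unboundedness of the fixed-precision
exponents (stub C, open). This file makes the ladder's FOOT kernel-checked — the card's
necessary-use constraint `ValiantLowBitsInP` at its first rung [cite: Valiant1979, Thm. 4 (case k = 1)]: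

* `permLowBits_one_mem_P` : the rung `k = 1` — the words `⟨s, bin 0⟩`, `|s| = n²`, with bit `0` of
  `perm_ℕ(M_s)` equal to `1`, i.e. the 0/1 matrices with ODD permanent — is in `P`;
* `permLowBits_zero_eq_empty`, `permLowBits_mem_P_of_le_one` : the rung `k = 0` is empty, so every
  rung `k ≤ 1` is in `P`.

So the crux is FALSE at precision `1`: any proof of `PermanentNotInP` must use an ingredient that
fails for `PermLowBits 1`, and in stub C (`∀ c, ∃ k, PermLowBits k ∉ DTIME(n^c)`) the witness `k` is
eventually `≥ 2`.

Proof. `perm(M) ≡ det(M) (mod 2)` (the signs of `det` are `±1 = 1` in characteristic two: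
`det_eq_permanent_of_charTwo`), so bit `0` of `perm_ℕ(M_s)` is the parity of the INTEGER determinant
of `M_s` (`testBit_permWord_zero_eq`). The decider parses `x = ⟨s, t⟩` by the total projections
`fstF`/`sndF` (well-formedness `wfB` of the tree's `PermCert` objects: `x` re-pairs to itself and
`|s|` is a perfect square), checks `⟦t⟧ = 0`, builds the row list of the `√|s| × √|s|` integer
matrix of `s` by two nested bounded `map`s of the typed polynomial-time calculus `CodeFP`
(`rowsZ_codeFP`), runs the tree's polynomial-time exact integer determinant
`IntDetFP.detZ_codeFP` (Berkowitz's algorithm; exact on genuine matrices by `IntDetFP.detZ_rows`) and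
outputs the parity of its absolute value. A language cut out by a `CodeFP` bit is in `P`
(the tree's `LFKN.setOf_codeFP_mem_P`, i.e. `mem_P_of_mem_FP`).

Lead prover-line-stmt-PneNP-16143-c1-0 (continuation c1), `--supports stmt-PneNP-16143`.
-/

set_option linter.dupNamespace false -- `Summit.PneNP.PneNP.…`: summit = sub-problem name (D-0017 single-conjunct layout)

namespace Summit.PneNP.PneNP.Theorems.XpLadder

open _root_.Computability Literature.Computability.Complexity Literature.Computability.Complexity.Brick
  Literature.Computability.Complexity.CodeFP Summit.PneNP.PneNP.Theorems.PermCert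

/-! ### §1 The permanent is the determinant modulo two -/

/-- Over a ring of characteristic two the determinant IS the permanent (every sign `±1` acts as `1`).
[folklore] -/
theorem det_eq_permanent_of_charTwo {R : Type} [CommRing R] [CharP R 2] {m : ℕ}
    (N : Matrix (Fin m) (Fin m) R) : N.det = N.permanent := by
  rw [Matrix.det_apply, Matrix.permanent]
  refine Finset.sum_congr rfl fun σ _ => ?_
  rcases Int.units_eq_one_or (Equiv.Perm.sign σ) with h | h
  · rw [h, one_smul]
  · rw [h, Units.smul_def, Units.val_neg, Units.val_one, neg_smul, one_smul, CharTwo.neg_eq]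

/-- The permanent over `ℕ`, reduced modulo two, is the permanent of the reduced matrix. [folklore] -/
theorem natCast_permanent_zmod_two {m : ℕ} (M : Matrix (Fin m) (Fin m) ℕ) :
    ((M.permanent : ℕ) : ZMod 2) = (M.map (Nat.cast : ℕ → ZMod 2)).permanent := by
  simp [Matrix.permanent, Matrix.map_apply]

/-- The integer determinant, reduced modulo two, is the determinant of the reduced matrix. [folklore] -/
theorem intCast_det_zmod_two {m : ℕ} (Z : Matrix (Fin m) (Fin m) ℤ) :
    ((Z.det : ℤ) : ZMod 2) = (Z.map (Int.cast : ℤ → ZMod 2)).det := by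
  rw [show ((Z.det : ℤ) : ZMod 2) = Int.castRingHom (ZMod 2) Z.det from rfl, RingHom.map_det,
    RingHom.mapMatrix_apply]
  rfl

/-- **`perm ≡ det (mod 2)` for 0/1 word matrices, as a statement about bit `0`**: bit `0` of the
permanent over `ℕ` of the `m × m` word matrix of `s` is the parity of the determinant of the same
matrix read over `ℤ`. [folklore] -/
theorem testBit_permWord_zero_eq (m : ℕ) (s : List Bool) :
    (permWord m s).testBit 0 =
      decide ((Matrix.of fun a b : Fin m =>
        if s.getD ((b : ℕ) + m * (a : ℕ)) false then (1 : ℤ) else 0).det.natAbs % 2 = 1) := by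
  set Z : Matrix (Fin m) (Fin m) ℤ :=
    Matrix.of fun a b : Fin m => if s.getD ((b : ℕ) + m * (a : ℕ)) false then (1 : ℤ) else 0 with hZ
  -- both matrices reduce to the same matrix over `ZMod 2`
  have hred : (matOfWord m s).map (Nat.cast : ℕ → ZMod 2) = Z.map (Int.cast : ℤ → ZMod 2) := by
    ext a b
    simp only [matOfWord, hZ, Matrix.map_apply, Matrix.of_apply]
    split_ifs <;> simp
  have hcast : ((permWord m s : ℕ) : ZMod 2) = ((Z.det : ℤ) : ZMod 2) := by
    rw [permWord, natCast_permanent_zmod_two, intCast_det_zmod_two, hred,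
      det_eq_permanent_of_charTwo]
  -- parity bookkeeping: both sides say "the common residue is `1`"
  have key : permWord m s % 2 = 1 ↔ Z.det.natAbs % 2 = 1 := by
    rw [← Nat.odd_iff, ← Nat.odd_iff, Int.natAbs_odd, ← ZMod.natCast_eq_one_iff_odd,
      ← ZMod.intCast_eq_one_iff_odd, hcast]
  rw [Nat.testBit_zero]
  exact decide_eq_decide.mpr key

/-! ### §2 The row list of the integer word matrix -/

/-- `List.ofFn` over `Fin n` is the `map` over `List.range n` of any extension to `ℕ`. [folklore] -/
theorem ofFn_eq_map_range {α : Type} {n : ℕ} (f : Fin n → α) (g : ℕ → α)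
    (h : ∀ i : Fin n, f i = g i) : List.ofFn f = (List.range n).map g := by
  apply List.ext_getElem
  · simp
  · intro i h₁ h₂
    rw [List.getElem_ofFn, List.getElem_map, List.getElem_range]
    exact h ⟨i, by simpa using h₁⟩

/-- **The integer word matrix as nested bounded loops**: the row list (`Berkowitz.rows`) of the
`m × m` integer word matrix of `s` is the double `map` over `List.range m` of the entry function
`(a, b) ↦ [s[b + m·a]]`. [folklore] -/
theorem rows_wordMatrix_eq (m : ℕ) (s : List Bool) :
    Literature.LinearAlgebra.Matrix.Berkowitz.rows
        (Matrix.of fun a b : Fin m => if s.getD ((b : ℕ) + m * (a : ℕ)) false then (1 : ℤ) else 0) =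
      (List.range m).map fun a => (List.range m).map fun b =>
        if s.getD (b + m * a) false then (1 : ℤ) else 0 := by
  rw [Literature.LinearAlgebra.Matrix.Berkowitz.rows]
  refine ofFn_eq_map_range _ _ fun a => ?_
  refine ofFn_eq_map_range _ _ fun b => ?_
  simp [Matrix.of_apply]

/-! ### §3 The decider in the typed polynomial-time calculus `CodeFP` -/

/-- **One entry** `((⟨m, s⟩, a), b) ↦ [s[b + m·a]] ∈ {0, 1} ⊆ ℤ` (context: side `m` in unary, the
word `s`, the row `a`). [cite: AroraBarak2009, §1.3 (composition of polynomial-time functions)] -/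
theorem entryZ_codeFP :
    CodeFP (pairE (pairE (pairE unE strE) natE) natE) intE
      (fun q => if q.1.1.2.getD (q.2 + q.1.1.1 * q.1.2) false then (1 : ℤ) else 0) := by
  have hs : CodeFP (pairE (pairE (pairE unE strE) natE) natE) strE (fun q => q.1.1.2) :=
    ((fst _ _).fst').snd'
  have hm : CodeFP (pairE (pairE (pairE unE strE) natE) natE) natE (fun q => q.1.1.1) :=
    (natOfUn.comp ((fst _ _).fst').fst' :)
  have ha : CodeFP (pairE (pairE (pairE unE strE) natE) natE) natE (fun q => q.1.2) := (fst _ _).snd'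
  have hb : CodeFP (pairE (pairE (pairE unE strE) natE) natE) natE (fun q => q.2) := snd _ _
  have hidx : CodeFP (pairE (pairE (pairE unE strE) natE) natE) natE
      (fun q => q.2 + q.1.1.1 * q.1.2) := natAdd.comp (hb.pair (natMul.comp (hm.pair ha)))
  have hbit : CodeFP (pairE (pairE (pairE unE strE) natE) natE) bitE
      (fun q => q.1.1.2.getD (q.2 + q.1.1.1 * q.1.2) false) := strGetDNat.comp (hs.pair hidx)
  exact hbit.ite (const _ (1 : ℤ)) (const _ (0 : ℤ))

/-- **One row** `(⟨m, s⟩, a) ↦ [entry (a, b) | b < m]` (a bounded `map` of `entryZ_codeFP` over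
`List.range m`). [cite: AroraBarak2009, §1.3 (polynomially bounded loops)] -/
theorem rowZ_codeFP :
    CodeFP (pairE (pairE unE strE) natE) (rawE intE)
      (fun p => (List.range p.1.1).map fun b =>
        if p.1.2.getD (b + p.1.1 * p.2) false then (1 : ℤ) else 0) := by
  have h := map (σ := (ℕ × List Bool) × ℕ) (eσ := pairE (pairE unE strE) natE) (eα := natE)
    entryZ_codeFP
  have hr : CodeFP (pairE (pairE unE strE) natE)
      (pairE (pairE (pairE unE strE) natE) (rawE natE)) (fun p => (p, List.range p.1.1)) :=
    (CodeFP.id _).pair (urange.comp (fst _ _).fst')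
  exact (h.comp hr).congr fun _ => rfl

/-- **The whole row list** `⟨m, s⟩ ↦ rows` (a bounded `map` of `rowZ_codeFP` over `List.range m`).
[cite: AroraBarak2009, §1.3 (polynomially bounded loops)] -/
theorem rowsZ_codeFP :
    CodeFP (pairE unE strE) (rawE (rawE intE))
      (fun σ => (List.range σ.1).map fun a => (List.range σ.1).map fun b =>
        if σ.2.getD (b + σ.1 * a) false then (1 : ℤ) else 0) := by
  have h := map (σ := ℕ × List Bool) (eσ := pairE unE strE) (eα := natE) rowZ_codeFP
  have hr : CodeFP (pairE unE strE) (pairE (pairE unE strE) (rawE natE))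
      (fun σ => (σ, List.range σ.1)) := (CodeFP.id _).pair (urange.comp (fst _ _))
  exact (h.comp hr).congr fun _ => rfl

/-- **The decider of the first rung is polynomial time on codes**: parse `x ↦ (fstF x, sndF x)`,
test well-formedness (`wfB`: `x` re-pairs to itself and `|fstF x|` is a perfect square), test
`⟦sndF x⟧ = 0`, and output the parity of the exact integer determinant (`IntDetFP.detZ`) of the
`√|s| × √|s|` word matrix. [cite: AroraBarak2009, §1.3] [cite: Berkowitz1984, §2] -/
theorem rungOneDecider_codeFP :
    CodeFP strE bitE (fun x => wfB x && (decide (bitsToNat (sndF x) = 0) &&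
      decide ((IntDetFP.detZ ((List.range (Nat.sqrt (fstF x).length)).map fun a =>
        (List.range (Nat.sqrt (fstF x).length)).map fun b =>
          if (fstF x).getD (b + Nat.sqrt (fstF x).length * a) false then (1 : ℤ) else 0)).natAbs
            % 2 = 1))) := by
  have hs : CodeFP strE strE fstF := of_fn fstF fstF_mem_FP fun _ => rfl
  have ht : CodeFP strE strE sndF := of_fn sndF sndF_mem_FP fun _ => rfl
  have hi : CodeFP strE natE (fun x => bitsToNat (sndF x)) := strVal.comp ht
  have hlenU : CodeFP strE unE (fun x => (fstF x).length) := strLength.comp hs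
  have hlen : CodeFP strE natE (fun x => (fstF x).length) := (natOfUn.comp hlenU :)
  -- well-formedness (the parse of the tree's `PermCert.wfB`)
  have hrepair : CodeFP strE strE (fun x => boolPair (fstF x) (encodeNat (bitsToNat (sndF x)))) :=
    (transparent (eα := pairE strE natE) (eβ := strE) (g := fun p => boolPair p.1 (encodeNat p.2))
      fun _ => rfl).comp (hs.pair hi)
  have heq : CodeFP strE bitE
      (fun x => decide (boolPair (fstF x) (encodeNat (bitsToNat (sndF x))) = x)) :=
    (CodeFP.eq (eα := strE) fun _ _ h => h).comp (hrepair.pair (CodeFP.id strE))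
  have hsq : CodeFP strE bitE (fun x =>
      decide (Nat.sqrt (fstF x).length * Nat.sqrt (fstF x).length = (fstF x).length)) :=
    natEq.comp ((natMul.comp ((natSqrt.comp hlen).pair (natSqrt.comp hlen))).pair hlen)
  have hwf : CodeFP strE bitE wfB :=
    (heq.and hsq).congr fun x => by simp only [wfB, Bool.decide_and]
  -- the bit index is `0`
  have hz : CodeFP strE bitE (fun x => decide (bitsToNat (sndF x) = 0)) :=
    natEq.comp (hi.pair (const strE 0))
  -- the side `√|s|` in unary (capped conversion: `min (√L) L = √L`)
  have hmU : CodeFP strE unE (fun x => Nat.sqrt (fstF x).length) :=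
    (unOfNatMin.comp (hlenU.pair (natSqrt.comp hlen))).congr fun x =>
      min_eq_left (Nat.sqrt_le_self _)
  -- rows, determinant, parity
  have hrows : CodeFP strE (rawE (rawE intE)) (fun x =>
      (List.range (Nat.sqrt (fstF x).length)).map fun a =>
        (List.range (Nat.sqrt (fstF x).length)).map fun b =>
          if (fstF x).getD (b + Nat.sqrt (fstF x).length * a) false then (1 : ℤ) else 0) :=
    (rowsZ_codeFP.comp (hmU.pair hs)).congr fun _ => rfl
  have hdet := IntDetFP.detZ_codeFP.comp hrows
  have hpar : CodeFP strE bitE (fun x =>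
      decide ((IntDetFP.detZ ((List.range (Nat.sqrt (fstF x).length)).map fun a =>
        (List.range (Nat.sqrt (fstF x).length)).map fun b =>
          if (fstF x).getD (b + Nat.sqrt (fstF x).length * a) false then (1 : ℤ) else 0)).natAbs
            % 2 = 1)) :=
    (natEq.comp ((natMod.comp ((intNatAbs.comp hdet).pair (const _ 2))).pair (const _ 1))).congr
      fun _ => rfl
  exact hwf.and (hz.and hpar)

/-! ### §4 The rungs `k ≤ 1` of the precision ladder are in `P` -/

/-- **The exact polynomial-time integer determinant decides the first rung**: on a well-formed query
the decider's determinant is the determinant of the word matrix of side `√|s|`. [cite: Berkowitz1984, §2] -/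
theorem detZ_rows_word (m : ℕ) (s : List Bool) :
    IntDetFP.detZ ((List.range m).map fun a => (List.range m).map fun b =>
        if s.getD (b + m * a) false then (1 : ℤ) else 0) =
      (Matrix.of fun a b : Fin m => if s.getD ((b : ℕ) + m * (a : ℕ)) false then (1 : ℤ) else 0).det := by
  rw [← rows_wordMatrix_eq, IntDetFP.detZ_rows]

/-- **LADDER BASE, rung 1: `PermLowBits 1 ∈ P`.** The words `⟨s, bin i⟩` with `i < 1`, `|s| = n²`
and bit `i` of `perm_ℕ(M_s)` equal to `1` — i.e. the 0/1 matrices with odd permanent, tagged with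
`bin 0` — form a polynomial-time language (the crux's set-builder with the guard `i < 1`, verbatim
as in the skeleton's `stub_unboundedPrecisionExponent`). [cite: Valiant1979, Thm. 4 (case k = 1)] -/
theorem permLowBits_one_mem_P :
    ({w | ∃ (n : ℕ) (s : List Bool) (i : ℕ), i < 1 ∧ s.length = n * n ∧
        w = Literature.Computability.Complexity.boolPair s (Computability.encodeNat i) ∧
        Nat.testBit (Matrix.permanent (Matrix.of fun a b : Fin n =>
          if s.getD ((b : ℕ) + n * (a : ℕ)) false then (1 : ℕ) else 0)) i = true} : Language Bool) ∈
      Literature.Computability.Complexity.Classes.P := by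
  have hP := LFKN.setOf_codeFP_mem_P rungOneDecider_codeFP
  convert hP using 1
  ext x
  constructor
  · rintro ⟨n, s, i, hi, hs, rfl, hbit⟩
    obtain rfl : i = 0 := Nat.lt_one_iff.1 hi
    have hsq : Nat.sqrt (n * n) = n := Nat.sqrt_eq n
    show (wfB _ && _) = true
    simp only [wfB, fstF_boolPair, sndF_boolPair, bitsToNat_encodeNat, hs, hsq, and_self,
      decide_true, Bool.true_and]
    rw [detZ_rows_word, ← testBit_permWord_zero_eq]
    exact hbit
  · intro hx
    change (wfB x && _) = true at hx
    simp only [Bool.and_eq_true, wfB, decide_eq_true_eq] at hx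
    obtain ⟨⟨hpair, hsq⟩, hi0, hpar⟩ := hx
    refine ⟨Nat.sqrt (fstF x).length, fstF x, 0, Nat.one_pos, hsq.symm, ?_, ?_⟩
    · rw [← hi0]; exact hpair.symm
    · change (permWord _ _).testBit 0 = true
      rw [testBit_permWord_zero_eq, decide_eq_true_iff, ← detZ_rows_word]
      exact hpar

/-- **Rung 0 is empty**: no word has a bit index `i < 0`. [folklore] -/
theorem permLowBits_zero_eq_empty :
    ({w | ∃ (n : ℕ) (s : List Bool) (i : ℕ), i < 0 ∧ s.length = n * n ∧
        w = Literature.Computability.Complexity.boolPair s (Computability.encodeNat i) ∧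
        Nat.testBit (Matrix.permanent (Matrix.of fun a b : Fin n =>
          if s.getD ((b : ℕ) + n * (a : ℕ)) false then (1 : ℕ) else 0)) i = true} : Language Bool) =
      (∅ : Set (List Bool)) := by
  ext w
  simp

/-- The empty language is in `P` (decided by the constant bit `false`). [folklore] -/
theorem empty_mem_P : (∅ : Set (List Bool)) ∈ Literature.Computability.Complexity.Classes.P := by
  have h := LFKN.setOf_codeFP_mem_P (const strE false)
  simpa using h

/-- **LADDER BASE: every rung `k ≤ 1` of the precision ladder is in `P`** (rung `0` is empty, rung
`1` is the parity of the permanent = of the determinant). Hence in stub C of the line `Sketch`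
(`∀ c, ∃ k, PermLowBits k ∉ DTIME(n^c)`) the witnessing precision is eventually `≥ 2`, and the crux
`PermanentNotInP` is false at precision `≤ 1`. [cite: Valiant1979, Thm. 4 (case k ≤ 1)] -/
theorem permLowBits_mem_P_of_le_one (k : ℕ) (hk : k ≤ 1) :
    ({w | ∃ (n : ℕ) (s : List Bool) (i : ℕ), i < k ∧ s.length = n * n ∧
        w = Literature.Computability.Complexity.boolPair s (Computability.encodeNat i) ∧
        Nat.testBit (Matrix.permanent (Matrix.of fun a b : Fin n =>
          if s.getD ((b : ℕ) + n * (a : ℕ)) false then (1 : ℕ) else 0)) i = true} : Language Bool) ∈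
      Literature.Computability.Complexity.Classes.P := by
  interval_cases k
  · rw [permLowBits_zero_eq_empty]; exact empty_mem_P
  · exact permLowBits_one_mem_P

/-- **Registered stub `stub_ladderBase` of the line `Sketch`** (crux stmt-PneNP-16143): every rung
`k ≤ 1` of the precision ladder is in `P` — `permLowBits_mem_P_of_le_one`, in the registered
`∀`-form. [cite: Valiant1979, Thm. 4 (case k ≤ 1)] -/
theorem stub_ladderBase : ∀ k : ℕ, k ≤ 1 → ({w | ∃ (n : ℕ) (s : List Bool) (i : ℕ), i < k ∧ s.length = n * n ∧ w = Literature.Computability.Complexity.boolPair s (Computability.encodeNat i) ∧ Nat.testBit (Matrix.permanent (Matrix.of fun a b : Fin n => if s.getD ((b : ℕ) + n * (a : ℕ)) false then (1 : ℕ) else 0)) i = true} : Language Bool) ∈ Literature.Computability.Complexity.Classes.P :=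
  permLowBits_mem_P_of_le_one

/-! ### §5 Consequence for stub C: the witnessing precision is eventually `≥ 2` -/

/-- `n ^ a ≤ n ^ b + 1` for `a ≤ b` (the `+ 1` absorbs `0 ^ 0 = 1`). [folklore] -/
theorem pow_le_pow_add_one {a b : ℕ} (h : a ≤ b) (n : ℕ) : n ^ a ≤ n ^ b + 1 := by
  rcases Nat.eq_zero_or_pos n with rfl | hn
  · exact (Nat.pow_le_pow_left (Nat.zero_le 1) a).trans (by rw [one_pow]; exact Nat.le_add_left 1 _)
  · exact (Nat.pow_le_pow_right hn h).trans (Nat.le_succ _)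

/-- **`DTIME(n^a) ⊆ DTIME(n^b)` for `a ≤ b`** (constant `2c` absorbs the `+ 1`). [cite: AroraBarak2009, Def. 1.12] -/
theorem DTIME_pow_mono {a b : ℕ} (h : a ≤ b) :
    Literature.Computability.Complexity.DTIME (fun n => n ^ a) ⊆
      Literature.Computability.Complexity.DTIME (fun n => n ^ b) := by
  rintro L ⟨c, hc⟩
  refine ⟨2 * c, timeClass_mono (fun n => ?_) hc⟩
  have h1 := Nat.mul_le_mul_left c (pow_le_pow_add_one h n)
  have h2 : c * n ^ b ≤ 2 * c * n ^ b := by nlinarith [Nat.zero_le (c * n ^ b)]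
  nlinarith

/-- **The foot of the ladder never witnesses stub C from some exponent on**: there is `c₁` such that
every rung `k ≤ 1` is in `DTIME(n^c)` for all `c ≥ c₁`; hence a witness `k` of
`PermLowBits k ∉ DTIME(n^c)` with `c ≥ c₁` (as produced by `stub_unboundedPrecisionExponent`) has
`2 ≤ k`. [cite: Valiant1979, Thm. 4 (case k ≤ 1)] -/
theorem two_le_of_permLowBits_not_mem_DTIME :
    ∃ c₁ : ℕ, ∀ c : ℕ, c₁ ≤ c → ∀ k : ℕ,
      ({w | ∃ (n : ℕ) (s : List Bool) (i : ℕ), i < k ∧ s.length = n * n ∧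
          w = Literature.Computability.Complexity.boolPair s (Computability.encodeNat i) ∧
          Nat.testBit (Matrix.permanent (Matrix.of fun a b : Fin n =>
            if s.getD ((b : ℕ) + n * (a : ℕ)) false then (1 : ℕ) else 0)) i = true} : Language Bool) ∉
        Literature.Computability.Complexity.DTIME (fun n => n ^ c) → 2 ≤ k := by
  obtain ⟨a, ha⟩ := Set.mem_iUnion.1 (permLowBits_mem_P_of_le_one 0 (Nat.zero_le 1))
  obtain ⟨b, hb⟩ := Set.mem_iUnion.1 (permLowBits_mem_P_of_le_one 1 le_rfl)
  refine ⟨max a b, fun c hc k hk => ?_⟩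
  by_contra hlt
  push Not at hlt
  interval_cases k
  · exact hk (DTIME_pow_mono ((le_max_left a b).trans hc) ha)
  · exact hk (DTIME_pow_mono ((le_max_right a b).trans hc) hb)

end Summit.PneNP.PneNP.Theorems.XpLadder
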